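import Literature.Computability.Complexity.PromiseCookNP
import Literature.Computability.Complexity.AdaptiveQueries
import HarnessLib

/-!
# Every `P^A` language is a bounded adaptive reduction: `P^A = {adLang Q q D A}` (normal form)

Topic `Computability/Complexity`, companion of `AdaptiveQueries.lean`. There a **bounded adaptive
reduction** — a query generator `Q ∈ FP` reading the input and the answer bits received so far, a
polynomial round budget `q` and an evaluator `D ∈ P` — is shown to land in `P^A`
(`AdQuery.adLang_mem_PRel`: `adLang Q q D A = {w | ⟨w, adBits Q A w (q|w|)⟩ ∈ D} ∈ P^A`). This file
proves the converse, so that the two presentations of polynomial-time Turing reducibility coincide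
(Ladner–Lynch–Selman 1975, §2: an oracle machine "computes its next query from the input and the
answers to the previous ones"; Arora–Barak 2009, §3.4):

* `AdQuery.qryFn M` — the query generator of an oracle algorithm `M` of the transcript model
  (`Oracle.lean`): on `⟨w, bs⟩` it returns the query that `M` asks after the one-bit answers `bs`
  (the tail of the step code `PromiseCookNP.last0`; junk `[b]` when that step outputs `b`);
* `AdQuery.haltLang M` — the evaluator: `⟨w, bs⟩ ∈ haltLang M` iff along some prefix of the answer
  bits `bs` every step of `M` is a query and the step after that prefix outputs `1` (a `bexLang`
  loop over the `ballLang` language `PromiseCookNP.bodyQ` and the final-step test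
  `PromiseCookNP.FinL`, so `haltLang M ∈ P`);
* **`AdQuery.eq_adLang_of_run`**, **`AdQuery.exists_eq_adLang_of_mem_PRel`** — if `M` decides `W`
  with oracle `A` within `q(|w|)` rounds then `W = adLang (qryFn M) q (haltLang M) A`; hence every
  `W ∈ P^A` is `adLang Q q D A` for some `Q ∈ FP`, `D ∈ P` and polynomial `q`
  (with `exists_eq_adLang_of_mem_PRel'` recording also an output-length bound for `Q`).

The point of the normal form: against EVERY oracle the answer string `adBits Q A w (q|w|)` has the
fixed length `q(|w|)` (the run of `M` itself halts after a number of rounds depending on the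
answers), which is what counting arguments over guessed transcripts need (Torán 1991, §4:
`C·P^{A}` analysed by guessing the oracle answers; consumer `CountingHierarchyOracle.lean`).
Proof: by the round induction of `PRelHierarchy.lean` (`PRelSigma.run_eq_some_iff`,
`PRelSigma.trans`) the true transcript of `M` is the one-bit transcript of a prefix of
`adBits (qryFn M) A w (q|w|)`, and the first output round is unique.

## References

* R. E. Ladner, N. A. Lynch, A. L. Selman, *A comparison of polynomial time reducibilities*,
  Theoret. Comput. Sci. 1 (1975) 103–123, §2 (`≤ᵖ_T`).
* S. Arora, B. Barak, *Computational Complexity: A Modern Approach*, CUP 2009, §3.4 (oracle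
  machines: the next query depends on the input and the previous answers).
* J. Torán, *Complexity classes defined by counting quantifiers*, J. ACM 38 (1991) 753–774, §4.
-/

namespace Literature.Computability.Complexity

open _root_.Computability Polynomial PRelSigma PromiseCookNP

namespace AdQuery

variable (M : OracleAlg Bool)

/-! ### The query generator and the evaluator of an oracle algorithm -/

/-- **The query generator of `M`**: `qryFn M ⟨w, bs⟩` is the query asked by `M` on input `w` after
the one-bit answers `bs` (the tail of the step code; junk `[b]` if that step outputs `b`).
[Arora–Barak 2009, §3.4] [folklore] -/
def qryFn : List Bool → List Bool := List.tail ∘ last0 M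

/-- The halting language read on a prefix: `⟨⟨w, bs⟩, 1ᵗ⟩ ↦ ⟨w, bs ↾ t⟩` lies in
`FinL M true ⊓ ballLang X (bodyQ M)` (the step after `bs ↾ t` outputs `1`, all earlier steps are
queries). [folklore] -/
noncomputable def haltBody : Language Bool :=
  pairFn xFn pre1 ⁻¹' (FinL M true ⊓ ballLang X (bodyQ M))

/-- **The evaluator of `M`**: `⟨w, bs⟩ ∈ haltLang M` iff for some `t`, along the answers `bs ↾ t`
every step of `M` is a query and the step after them outputs `1`. [Arora–Barak 2009, §3.4] [folklore] -/
noncomputable def haltLang : Language Bool := bexLang X (haltBody M)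

variable {M}

/-- `qryFn M ∈ FP` for polynomial-time `M`. [folklore] -/
theorem qryFn_mem_FP (hM : M.IsPolyTime encodingBoolBool) : qryFn M ∈ FP :=
  comp_mem_FP tail_mem_FP (last0_mem_FP hM)

/-- `qryFn M ⟨w, bs⟩` is `PromiseCookNP.qryAt` at round `|bs|`. [folklore] -/
theorem qryFn_boolPair (w bs : List Bool) :
    qryFn M (boolPair w bs) = (stepCode (M.step w (bitsTrans bs))).tail := by
  rw [qryFn, Function.comp_apply, last0_apply]

/-- If the step after `bs` is the query `y` then `qryFn M ⟨w, bs⟩ = y`. [folklore] -/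
theorem qryFn_eq_of_step_eq {w bs y : List Bool} (h : M.step w (bitsTrans bs) = Sum.inl y) :
    qryFn M (boolPair w bs) = y := by
  rw [qryFn_boolPair, h, stepCode_inl, List.tail_cons]

/-- `haltBody M ∈ P` for polynomial-time `M`. [folklore] -/
theorem haltBody_mem_P (hM : M.IsPolyTime encodingBoolBool) : haltBody M ∈ Classes.P :=
  preimage_mem_P (inter_mem_P (FinL_mem_P hM true) (ballLang_mem_P X (bodyQ_mem_P hM)))
    (pairFn_mem_FP xFn_mem_FP pre1_mem_FP)

/-- **`haltLang M ∈ P`** for polynomial-time `M`. [Arora–Barak 2009, §1.3 (loops)] [folklore] -/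
theorem haltLang_mem_P (hM : M.IsPolyTime encodingBoolBool) : haltLang M ∈ Classes.P :=
  bexLang_mem_P X (haltBody_mem_P hM)

/-- Reading `haltBody`. [folklore] -/
theorem mem_haltBody_iff (w bs : List Bool) (t : ℕ) :
    boolPair (boolPair w bs) (List.replicate t true) ∈ haltBody M ↔
      M.step w (bitsTrans (bs.take t)) = Sum.inr true ∧
        ∀ j < (bs.take t).length, ∃ y, M.step w (bitsTrans ((bs.take t).take j)) = Sum.inl y := by
  change pairFn xFn pre1 (boolPair (boolPair w bs) (List.replicate t true)) ∈ FinL M true ⊓ ballLang X (bodyQ M) ↔ _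
  rw [pairFn_apply, xFn_apply, pre1_apply, List.length_replicate]
  change boolPair w (bs.take t) ∈ FinL M true ∧ boolPair w (bs.take t) ∈ ballLang X (bodyQ M) ↔ _
  rw [mem_FinL_iff, mem_ballLang_bodyQ_iff]

/-- **Reading `haltLang`**: some prefix `bs ↾ t`, `t ≤ |bs|`, consists of query rounds and is
followed by the output `1`. [folklore] -/
theorem mem_haltLang_iff (w bs : List Bool) :
    boolPair w bs ∈ haltLang M ↔ ∃ t ≤ bs.length,
      M.step w (bitsTrans (bs.take t)) = Sum.inr true ∧
        ∀ j < t, ∃ y, M.step w (bitsTrans (bs.take j)) = Sum.inl y := by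
  change boolPair w bs ∈ bexLang X (haltBody M) ↔ _
  rw [mem_bexLang, eval_X, length_boolPair]
  constructor
  · rintro ⟨t, -, ht⟩
    rw [mem_haltBody_iff] at ht
    obtain ⟨hfin, hall⟩ := ht
    refine ⟨min t bs.length, min_le_right _ _, ?_, fun j hj => ?_⟩
    · rwa [← List.take_take, List.take_length]
    · obtain ⟨y, hy⟩ := hall j (by rw [List.length_take]; exact hj)
      refine ⟨y, ?_⟩
      rwa [List.take_take, min_eq_left (le_of_lt (lt_min_iff.1 hj).1)] at hy
  · rintro ⟨t, ht, hfin, hall⟩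
    refine ⟨t, by omega, ?_⟩
    rw [mem_haltBody_iff]
    refine ⟨hfin, fun j hj => ?_⟩
    rw [List.length_take, min_eq_left ht] at hj
    rw [List.take_take, min_eq_left hj.le]
    exact hall j hj

/-! ### The true run follows the adaptive answer bits -/

/-- **The transcript of `M` against `A` is a prefix of the adaptive answer bits** of its own query
generator: if the first `m` steps along the true transcript are queries, then for `i ≤ m` the
transcript of the first `i` rounds is the one-bit transcript of `adBits (qryFn M) A w n ↾ i`
(any `n ≥ i`). [Arora–Barak 2009, §3.4] [folklore] -/
theorem trans_eq_bitsTrans_adBits (A : Language Bool) (w : List Bool) {m : ℕ}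
    (hq : ∀ i < m, ∃ y, M.step w (trans M (Oracle.ofLanguage A) w i) = Sum.inl y) :
    ∀ i ≤ m, trans M (Oracle.ofLanguage A) w i = bitsTrans (adBits (qryFn M) A w i)
  | 0, _ => by simp
  | i + 1, hi => by
    have ih := trans_eq_bitsTrans_adBits A w hq i (Nat.le_of_succ_le hi)
    obtain ⟨y, hy⟩ := hq i hi
    rw [trans_succ, ih, adBits_succ, bitsTrans_append, bitsTrans_singleton, ofLanguage_eq_singleton]
    rw [ih] at hy
    rw [qryOf_eq_of_step_eq hy, qryFn_eq_of_step_eq hy]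

/-- **The normal form.** If `M` with oracle `A` outputs `[w ∈ W]` within `q(|w|)` rounds on every
input, then `W` is the bounded adaptive reduction `adLang (qryFn M) q (haltLang M) A`.
[Ladner–Lynch–Selman 1975, §2; Arora–Barak 2009, §3.4] [cite: LadnerLynchSelman1975, §2] -/
theorem eq_adLang_of_run {A W : Language Bool} {q : Polynomial ℕ}
    (hrun : ∀ w, M.run (Oracle.ofLanguage A) (q.eval w.length) w = some (W.boolIndicator w)) :
    W = adLang (qryFn M) q (haltLang M) A := by
  ext w
  obtain ⟨m, hm, hall, hfin⟩ := (run_eq_some_iff M _ _ w _).1 (hrun w)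
  set bs := adBits (qryFn M) A w (q.eval w.length) with hbs
  have htr : ∀ i ≤ m, trans M (Oracle.ofLanguage A) w i = bitsTrans (bs.take i) := fun i hi => by
    rw [hbs, adBits_take A w (hi.trans hm.le)]
    exact trans_eq_bitsTrans_adBits A w hall i hi
  rw [mem_adLang_iff, ← hbs, mem_haltLang_iff]
  constructor
  · intro hw
    refine ⟨m, by rw [hbs, length_adBits]; exact hm.le, ?_, fun j hj => ?_⟩
    · rw [← htr m le_rfl, hfin, (Set.mem_iff_boolIndicator _ _).1 hw]
    · rw [← htr j hj.le]
      exact hall j hj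
  · rintro ⟨t, -, htfin, htall⟩
    rcases lt_trichotomy t m with hlt | rfl | hgt
    · obtain ⟨y, hy⟩ := hall t hlt
      rw [htr t hlt.le, htfin] at hy
      cases hy
    · rw [← htr t le_rfl, hfin, Sum.inr.injEq] at htfin
      exact (Set.mem_iff_boolIndicator _ _).2 htfin
    · obtain ⟨y, hy⟩ := htall m hgt
      rw [← htr m le_rfl, hfin] at hy
      cases hy

/-- **Every `P^A` language is a bounded adaptive reduction to `A`**: `W ∈ P^A` implies
`W = adLang Q q D A` for some query generator `Q ∈ FP`, evaluator `D ∈ P` and polynomial `q`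
(the converse of `AdQuery.adLang_mem_PRel`). [Ladner–Lynch–Selman 1975, §2] [cite: LadnerLynchSelman1975, §2] -/
theorem exists_eq_adLang_of_mem_PRel {A W : Language Bool} (hW : W ∈ PRel (Oracle.ofLanguage A)) :
    ∃ Q : List Bool → List Bool, Q ∈ FP ∧ ∃ D : Language Bool, D ∈ Classes.P ∧
      ∃ q : Polynomial ℕ, W = adLang Q q D A := by
  obtain ⟨M, hM, q, hq⟩ := hW
  exact ⟨qryFn M, qryFn_mem_FP hM, haltLang M, haltLang_mem_P hM, q, eq_adLang_of_run fun w => (hq w).1⟩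

/-- The same normal form together with an **output-length bound** for the query generator:
`|Q z| ≤ s(|z|)` for a polynomial `s` (every `FP` function has one,
`exists_poly_length_le_of_mem_FP`). [Ladner–Lynch–Selman 1975, §2] [cite: LadnerLynchSelman1975, §2] -/
theorem exists_eq_adLang_of_mem_PRel' {A W : Language Bool} (hW : W ∈ PRel (Oracle.ofLanguage A)) :
    ∃ Q : List Bool → List Bool, Q ∈ FP ∧ ∃ s : Polynomial ℕ, (∀ z, (Q z).length ≤ s.eval z.length) ∧
      ∃ D : Language Bool, D ∈ Classes.P ∧ ∃ q : Polynomial ℕ, W = adLang Q q D A := by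
  obtain ⟨Q, hQ, D, hD, q, h⟩ := exists_eq_adLang_of_mem_PRel hW
  obtain ⟨s, hs⟩ := exists_poly_length_le_of_mem_FP hQ
  exact ⟨Q, hQ, s, hs, D, hD, q, h⟩

end AdQuery

end Literature.Computability.Complexity
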